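import Literature.NumberTheory.Automorphic.Liu2021.AppendixC.OmegaHomIsotypicMultOne
import Literature.NumberTheory.Automorphic.Liu2021.AppendixC.OmegaHomBlockFieldCharacter
import Literature.NumberTheory.Automorphic.Liu2021.AppendixC.OmegaHomIsotypicComponentLevelwise
import Literature.RingTheory.SimpleModule.StableSubspacesSemilinearTransport
import HarnessLib

/-!
# [Liu 2021, App. D §D.4 / Prop. D.4 (1)] the `ε`-block `W_ε = (ᵗV_ℓ ε ⊗ 1)(ℚ̄_ℓ ⊗ H¹_ét(A_K))` of the Hecke image as a module over
# `ℚ̄_ℓ⟨Hecke⟩`: carrier, semisimplicity, the simple sub-block of `ω⋆`, and the central-character dictionary (piece 1 of the (MO) producer)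

Topic `NumberTheory/Automorphic/Liu2021/AppendixC`; namespace `Literature.NumberTheory.Automorphic.Liu2021.AppendixC.Sec42Data.HeckeTranslates`.
Theorems only — no definition, no named fact, no instance, no `sorry`.

Setting (the S2′ «(MO) socket» of the cell hodgecm-mathlib, crux HLiu418 = stmt-HodgeConjecture-24832; A-p11 probe v9 `SocketMultOne`): a §4.2 datum
`C` with translates `T`, row (D) `hD`, injective pull-backs `hI`, a prime `ℓ`, a small level `K`, `L := ℚ̄_ℓ`, `M := L ⊗ H¹_ét(A_K)`, the realised
endomorphisms `op x := ᵗV_ℓ^ℚ(x) ⊗ 1 ∈ End_L M` (`x ∈ End⁰(A_K)`), the Hecke image `H := heckeImage K`, and an idempotent `ε ∈ H` commuting with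
`H`.  The BLOCK CARRIER is `W_ε := range (op ε) ≤ M` with the restricted action `act′ h := op h|_{W_ε}` (`h ∈ H`) and the `L`-algebra
`A := L⟨range act′⟩ ≤ End_L W_ε`.  Everything below is phrased over an arbitrary pair `(W_ε, act′)` satisfying the two defining
equations (`hW`, `hact`), so that consumers never see a definition.

* §1 `exists_blockCarrier` — `(W_ε, act′)` exist; `forall_mem_blockCarrier_iff`, `op_apply_mem_blockCarrier`.
* §2 `isSemisimpleModule_blockCarrier` — `σ = 1 ⊗ rhoEt` semisimple ⇒ `W_ε` is a semisimple `A`-module (Hecke-stable complements in `M`,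
  ★ `exists_stable_isCompl_baseChange_etaleH1`, cut down to `W_ε`); `finite_isotypicComponents_blockCarrier`.
* §3 `exists_simple_omegaBlock` — the sub-block `N₀′ := {w ∈ W_ε | [w]_K ∈ f′(ω^K)}` of a non-zero `f′ ∈ Hom_G(ι∘ω, L ⊗ H¹_ét(A_∞))` whose
  classes `ε` fixes (`hsel`) is a SIMPLE `A`-submodule of `W_ε` (★ `eq_bot_or_coe_eq_of_forall_heckeEnd_stable`).
* §4 `forall_eigen_of_mem_isotypicComponent_blockCarrier` — for the block field `φ : R₀ → Z(H)ε` every simple `A`-submodule `N ≤ W_ε` has a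
  character `τ_N : R₀ →+* L` (Schur, ★ `BlockFieldCharacter`) and its isotypic component lies in the `τ_N`-eigenspace of the `act′ (φ r)`.
* §5 `eigen_omegaBlock_subset` — MULTIPLICITY ONE AT THE BASE BLOCK: every `w ∈ W_ε` on which the `act′ (φ r)` act through the character of
  `N₀′` lies in `N₀′` (★ `isotypicComponent_eq_of_forall_eq_smul` + the `M`-level dictionary ★ `mem_isotypicComponent_of_forall_smul_eq_smul`,
  ★ `mem_span_of_forall_comm_of_mul_eq`).

Piece 2 (`OmegaHomBlockMultOne`) adds the `Aut(ℚ̄_ℓ/ℚ)`-transport along the `ℚ`-form and concludes the (MO) socket.  HC_CM is proved only modulo the 7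
printed citations until rung 0 closes; this file moves no book.
Co-produced with A-p05 (g12) (cell hodgecm-mathlib; his monolith `OmegaHomBlockMultOne.reportfirst.A-p05g12.lean` is the twin road).


## References
* [Liu2021] Y. Liu, *Fourier–Jacobi cycles and arithmetic relative trace formula*, Camb. J. Math. 9 (2021): p. 133 (D.3), Prop. D.4 (1) p. 130,
  App. D §D.4 pp. 139–140 (FJcycle.tex l. 5626–5631).
* [Lam2001FirstCourse] T. Y. Lam, *A First Course in Noncommutative Rings* (2001), §3 Thm. (3.5), §22 Prop. (22.1)–(22.2).
* [Bump1997] D. Bump, *Automorphic Forms and Representations* (1997), §4.2 Prop. 4.2.3.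
-/

set_option autoImplicit false

noncomputable section

open CategoryTheory NumberField Function Cardinal
open scoped TensorProduct Cardinal

namespace Literature.NumberTheory.Automorphic.Liu2021.AppendixC

open Literature.AlgebraicGeometry.Motives (AbelianVariety)
open Literature.AlgebraicGeometry.Motives.AbelianVariety (rationalTateModuleMap endAlgebra rationalTateAction)

variable {F E : Type} [Field F] [NumberField F] [IsTotallyReal F] [Field E] [NumberField E] [Algebra F E]
  [IsTotallyComplex E] [Algebra.IsQuadraticExtension F E]
variable {P5 : PropC5Data F E} {isotropicAt : ℕ → Prop}

namespace Sec42Data.HeckeTranslates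

variable {C : Sec42Data P5 isotropicAt} (T : C.HeckeTranslates) {ℓ : ℕ} [Fact ℓ.Prime]
variable (K : C5.SmallLevel C.S.K₀)
  (hI : ∀ ⦃K K' : C5.SmallLevel C.S.K₀⦄ (f : K' ⟶ K), Function.Injective (rationalTateModuleMap ℓ (C.Atr f)).dualMap)
  (X : C.EtaleHeckeDatum ℓ) (hX : X.rhoEt = T.etHeckeRep ℓ) (ι : ℂ ≃+* AlgebraicClosure ℚ_[ℓ])
  {W : Type} [AddCommGroup W] [Module ℂ W] (ρW : Representation ℂ C.G W)
  {f : W →ₛₗ[(ι : ℂ →+* AlgebraicClosure ℚ_[ℓ])] AlgebraicClosure ℚ_[ℓ] ⊗[ℚ_[ℓ]] C.etaleH1Tower ℓ} (hf : f ∈ X.omegaHom ι ρW)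
  (σ : Representation (AlgebraicClosure ℚ_[ℓ]) C.G (AlgebraicClosure ℚ_[ℓ] ⊗[ℚ_[ℓ]] C.etaleH1Tower ℓ))
  (hσ : ∀ g : C.G, σ g = (X.rhoEt g).baseChange (AlgebraicClosure ℚ_[ℓ]))

/-! ## §1 The block carrier: a free model `W_ε ≅ range (ᵗV_ℓ ε ⊗ 1)` with the restricted Hecke action -/

/-- **The block carrier exists** (free model).  For an idempotent `ε ∈ End⁰(A_K)` commuting with `H = heckeImage K` there are `d`, an injective
`ℚ̄_ℓ`-linear `iW : ℚ̄_ℓ^d → ℚ̄_ℓ ⊗ H¹_ét(A_K)` with image `range (ᵗV_ℓ^ℚ ε ⊗ 1)`, and an action `act′ : H → End(ℚ̄_ℓ^d)` intertwined by `iW` with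
`h ↦ ᵗV_ℓ^ℚ h ⊗ 1` (`op` is anti-multiplicative and `ε` central in `H`, so `range (op ε)` is `op h`-stable; transport along a basis).  The free
model `Fin d → ℚ̄_ℓ` is chosen so that every instance on `End(W_ε)` is the canonical one.
[cite: Liu2021, App. D §D.4 (FJcycle.tex l. 5626–5631)] [cite: MumfordAV1970, §19 Thm. 3] -/
theorem exists_blockCarrier (hD : T.IsogenyDescent) {ε : (C.A K).endAlgebra} (hεc : ∀ h ∈ T.heckeImage hD K, ε * h = h * ε) :
    ∃ (d : ℕ) (iW : (Fin d → AlgebraicClosure ℚ_[ℓ]) →ₗ[AlgebraicClosure ℚ_[ℓ]] AlgebraicClosure ℚ_[ℓ] ⊗[ℚ_[ℓ]] C.etaleH1 ℓ K)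
      (act' : ↥(T.heckeImage hD K) → Module.End (AlgebraicClosure ℚ_[ℓ]) (Fin d → AlgebraicClosure ℚ_[ℓ])),
      Function.Injective iW ∧
      LinearMap.range iW = LinearMap.range (((rationalTateAction (C.A K) ℓ ε).dualMap).baseChange (AlgebraicClosure ℚ_[ℓ])) ∧
      ∀ (h : ↥(T.heckeImage hD K)) (w : Fin d → AlgebraicClosure ℚ_[ℓ]),
        iW (act' h w) = ((rationalTateAction (C.A K) ℓ (h : (C.A K).endAlgebra)).dualMap).baseChange (AlgebraicClosure ℚ_[ℓ]) (iW w) := by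
  classical
  set L := AlgebraicClosure ℚ_[ℓ]
  haveI := module_finite_baseChange_etaleH1 (C := C) ℓ K
  obtain ⟨op, hop⟩ : ∃ op : (C.A K).endAlgebra → Module.End L (L ⊗[ℚ_[ℓ]] C.etaleH1 ℓ K),
      op = fun x => ((rationalTateAction (C.A K) ℓ x).dualMap).baseChange L := ⟨_, rfl⟩
  have hop' : ∀ x, op x = ((rationalTateAction (C.A K) ℓ x).dualMap).baseChange L := fun x => by rw [hop]
  have op_mul : ∀ x y, op (x * y) = op y ∘ₗ op x := fun x y => by
    rw [hop', hop', hop']; exact baseChange_dualMap_rationalTateAction_mul ℓ K x y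
  -- `range (op ε)` is stable under `op h`, `h ∈ H`
  set R : Submodule L (L ⊗[ℚ_[ℓ]] C.etaleH1 ℓ K) := LinearMap.range (op ε) with hR
  have hstab : ∀ (h : ↥(T.heckeImage hD K)), ∀ m ∈ R, op (h : (C.A K).endAlgebra) m ∈ R := by
    rintro h _ ⟨m, rfl⟩
    refine ⟨op (h : (C.A K).endAlgebra) m, ?_⟩
    change (op ε ∘ₗ op (h : (C.A K).endAlgebra)) m = (op (h : (C.A K).endAlgebra) ∘ₗ op ε) m
    rw [← op_mul, ← op_mul, hεc _ h.2]
  -- a basis of `range (op ε)` and the free model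
  let b := Module.finBasis L ↥R
  set d := Module.finrank L ↥R
  let e : (Fin d → L) ≃ₗ[L] ↥R := b.equivFun.symm
  refine ⟨d, R.subtype ∘ₗ (e : (Fin d → L) →ₗ[L] ↥R),
    fun h => (e.symm : ↥R →ₗ[L] (Fin d → L)) ∘ₗ ((op (h : (C.A K).endAlgebra)).restrict (hstab h)) ∘ₗ (e : (Fin d → L) →ₗ[L] ↥R),
    ?_, ?_, fun h w => ?_⟩
  · exact Subtype.val_injective.comp e.injective
  · rw [LinearMap.range_comp, LinearEquiv.range, Submodule.map_top, Submodule.range_subtype, hR, hop']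
  · change ((e (e.symm (((op (h : (C.A K).endAlgebra)).restrict (hstab h)) (e w))) : ↥R) : L ⊗[ℚ_[ℓ]] C.etaleH1 ℓ K) =
      ((rationalTateAction (C.A K) ℓ (h : (C.A K).endAlgebra)).dualMap).baseChange L ((e w : ↥R) : _)
    rw [LinearEquiv.apply_symm_apply, LinearMap.restrict_apply, ← hop']

/-- Membership in the image of the block carrier: `m ∈ range (ᵗV_ℓ^ℚ ε ⊗ 1) ↔ (ᵗV_ℓ^ℚ ε ⊗ 1) m = m` (`ε` idempotent).
[cite: Lam2001FirstCourse, §22 Prop. (22.1) (p. 327)] -/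
theorem mem_range_baseChange_dualMap_iff {ε : (C.A K).endAlgebra} (hε : IsIdempotentElem ε)
    (m : AlgebraicClosure ℚ_[ℓ] ⊗[ℚ_[ℓ]] C.etaleH1 ℓ K) :
    m ∈ LinearMap.range (((rationalTateAction (C.A K) ℓ ε).dualMap).baseChange (AlgebraicClosure ℚ_[ℓ])) ↔
      ((rationalTateAction (C.A K) ℓ ε).dualMap).baseChange (AlgebraicClosure ℚ_[ℓ]) m = m := by
  constructor
  · rintro ⟨m', rfl⟩
    change ((((rationalTateAction (C.A K) ℓ ε).dualMap).baseChange (AlgebraicClosure ℚ_[ℓ])) ∘ₗ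
      (((rationalTateAction (C.A K) ℓ ε).dualMap).baseChange (AlgebraicClosure ℚ_[ℓ]))) m' = _
    rw [← baseChange_dualMap_rationalTateAction_mul ℓ K, hε.eq]
  · intro hm
    exact ⟨m, hm⟩

/-! ## §2 `W_ε` is a semisimple `ℚ̄_ℓ⟨act′⟩`-module with finitely many isotypic components -/

section Carrier

variable {Wε : Type} [AddCommGroup Wε] [Module (AlgebraicClosure ℚ_[ℓ]) Wε]
  (iW : Wε →ₗ[AlgebraicClosure ℚ_[ℓ]] AlgebraicClosure ℚ_[ℓ] ⊗[ℚ_[ℓ]] C.etaleH1 ℓ K) (hiW : Function.Injective iW)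

include hiW in
/-- **`W_ε` is a semisimple module over `A := ℚ̄_ℓ⟨act′(H)⟩`** when `ℚ̄_ℓ ⊗ H¹_ét(A_K)` is a semisimple module over the realised Hecke algebra
`𝒜 = ℚ̄_ℓ⟨ᵗV_ℓ^ℚ(heckeEnd K g) ⊗ 1⟩` (the LEVELWISE hypothesis `hssM` of the cell's σ-free S2′ assembly, ★ `OmegaHomIsotypicComponentLevelwise`): an
`act′`-stable subspace `N ≤ W_ε` maps under `iW` to an `𝒜`-submodule, which has an `𝒜`-complement; its pull-back is an `act′`-stable complement in `W_ε`
(an `𝒜`-submodule is stable under every `ᵗV_ℓ^ℚ h ⊗ 1`, `h ∈ H = ℚ⟨heckeEnd⟩`, ★ `baseChange_dualMap_rationalTateAction_mem_adjoin`).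
[cite: Liu2021, p. 133 (D.3) and App. D §D.4 (FJcycle.tex l. 5626–5628)] [cite: Bump1997, §4.2 Prop. 4.2.3] -/
theorem isSemisimpleModule_blockCarrier (hD : T.IsogenyDescent)
    (hssM : ∀ K' : C5.SmallLevel C.S.K₀,
      IsSemisimpleModule ↥(Algebra.adjoin (AlgebraicClosure ℚ_[ℓ])
        ((Set.range fun g : C.G => ((rationalTateAction (C.A K') ℓ (T.heckeEnd hD K' g)).dualMap).baseChange (AlgebraicClosure ℚ_[ℓ])) :
          Set (Module.End (AlgebraicClosure ℚ_[ℓ]) (AlgebraicClosure ℚ_[ℓ] ⊗[ℚ_[ℓ]] C.etaleH1 ℓ K'))))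
        (AlgebraicClosure ℚ_[ℓ] ⊗[ℚ_[ℓ]] C.etaleH1 ℓ K'))
    (act' : ↥(T.heckeImage hD K) → Module.End (AlgebraicClosure ℚ_[ℓ]) Wε)
    (hact : ∀ (h : ↥(T.heckeImage hD K)) (w : Wε),
      iW (act' h w) = ((rationalTateAction (C.A K) ℓ (h : (C.A K).endAlgebra)).dualMap).baseChange (AlgebraicClosure ℚ_[ℓ]) (iW w)) :
    IsSemisimpleModule ↥(Algebra.adjoin (AlgebraicClosure ℚ_[ℓ]) (Set.range act')) Wε := by
  classical
  obtain ⟨S, hS⟩ : ∃ S : Set (Module.End (AlgebraicClosure ℚ_[ℓ]) (AlgebraicClosure ℚ_[ℓ] ⊗[ℚ_[ℓ]] C.etaleH1 ℓ K)),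
      S = Set.range fun g : C.G => ((rationalTateAction (C.A K) ℓ (T.heckeEnd hD K g)).dualMap).baseChange (AlgebraicClosure ℚ_[ℓ]) :=
    ⟨_, rfl⟩
  have hssK : IsSemisimpleModule ↥(Algebra.adjoin (AlgebraicClosure ℚ_[ℓ]) S) (AlgebraicClosure ℚ_[ℓ] ⊗[ℚ_[ℓ]] C.etaleH1 ℓ K) := by
    rw [hS]; exact hssM K
  have hcl := (isSemisimpleModule_iff _ _).1 hssK
  refine Literature.NumberTheory.Automorphic.isSemisimpleModule_adjoin_of_forall_exists_isCompl (Set.range act') fun N hN => ?_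
  -- push `N` into `M`; it is Hecke-stable there, hence an `𝒜`-submodule with an `𝒜`-complement
  obtain ⟨N', hN'⟩ : ∃ N' : Submodule (AlgebraicClosure ℚ_[ℓ]) (AlgebraicClosure ℚ_[ℓ] ⊗[ℚ_[ℓ]] C.etaleH1 ℓ K), N' = N.map iW := ⟨_, rfl⟩
  have hmemN' : ∀ x, x ∈ N' ↔ ∃ w ∈ N, iW w = x := fun x => by rw [hN', Submodule.mem_map]
  have hN'S : ∀ s ∈ S, ∀ n ∈ N', s n ∈ N' := by
    intro s hs x hx
    rw [hS] at hs
    obtain ⟨g, rfl⟩ := hs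
    obtain ⟨w, hw, rfl⟩ := (hmemN' x).1 hx
    rw [hmemN']
    exact ⟨act' ⟨T.heckeEnd hD K g, T.heckeEnd_mem_heckeImage hD K g⟩ w, hN _ ⟨_, rfl⟩ w hw, hact _ w⟩
  obtain ⟨N'', hN''⟩ := Literature.NumberTheory.Automorphic.exists_submodule_adjoin_of_forall_mem S N' hN'S
  obtain ⟨C'', hNC''⟩ := hcl.exists_isCompl N''
  have hNC' : IsCompl N' (C''.restrictScalars (AlgebraicClosure ℚ_[ℓ])) := by
    rw [← hN'']; exact (Submodule.isCompl_restrictScalars_iff (S := AlgebraicClosure ℚ_[ℓ])).2 hNC''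
  -- `C''` is stable under every `op h`, `h ∈ H`
  have hC'H : ∀ (h : ↥(T.heckeImage hD K)), ∀ c ∈ C''.restrictScalars (AlgebraicClosure ℚ_[ℓ]),
      ((rationalTateAction (C.A K) ℓ (h : (C.A K).endAlgebra)).dualMap).baseChange (AlgebraicClosure ℚ_[ℓ]) c ∈
        C''.restrictScalars (AlgebraicClosure ℚ_[ℓ]) := by
    intro h c hc
    have hmem : ((rationalTateAction (C.A K) ℓ (h : (C.A K).endAlgebra)).dualMap).baseChange (AlgebraicClosure ℚ_[ℓ]) ∈
        Algebra.adjoin (AlgebraicClosure ℚ_[ℓ]) S := by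
      rw [hS]; exact T.baseChange_dualMap_rationalTateAction_mem_adjoin ℓ K hD h.2
    exact C''.smul_mem ⟨_, hmem⟩ hc
  -- the pull-back of `C''` to `W_ε`
  refine ⟨(C''.restrictScalars (AlgebraicClosure ℚ_[ℓ])).comap iW, fun s hs w hw => ?_, ?_⟩
  · obtain ⟨h, rfl⟩ := hs
    rw [Submodule.mem_comap] at hw ⊢
    rw [hact]
    exact hC'H h _ hw
  · refine ⟨Submodule.disjoint_def.2 fun w hwN hwC => ?_, codisjoint_iff.2 (Submodule.eq_top_iff'.2 fun w => ?_)⟩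
    · have h1 : iW w ∈ N' := (hmemN' _).2 ⟨w, hwN, rfl⟩
      have h3 := Submodule.disjoint_def.1 hNC'.disjoint _ h1 hwC
      exact hiW (by rw [h3, map_zero])
    · have htop : iW w ∈ N' ⊔ C''.restrictScalars (AlgebraicClosure ℚ_[ℓ]) := by rw [codisjoint_iff.1 hNC'.codisjoint]; trivial
      obtain ⟨n', hn', c', hc', hsum⟩ := Submodule.mem_sup.1 htop
      obtain ⟨n, hn, rfl⟩ := (hmemN' _).1 hn'
      have hc'W : c' = iW (w - n) := by rw [map_sub, ← hsum, add_sub_cancel_left]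
      refine Submodule.mem_sup.2 ⟨n, hn, w - n, ?_, add_sub_cancel n w⟩
      rw [Submodule.mem_comap, ← hc'W]
      exact hc'

omit hiW in
/-- The image of the block carrier is stable under every `ᵗV_ℓ^ℚ h ⊗ 1`, `h ∈ H` (`range iW = range (op ε)`, `ε` central in `H`).
[cite: Lam2001FirstCourse, §22 Prop. (22.1) (p. 327)] -/
theorem baseChange_dualMap_apply_mem_range_blockCarrier (hD : T.IsogenyDescent) {ε : (C.A K).endAlgebra}
    (hεc : ∀ h ∈ T.heckeImage hD K, ε * h = h * ε)
    (hW : LinearMap.range iW = LinearMap.range (((rationalTateAction (C.A K) ℓ ε).dualMap).baseChange (AlgebraicClosure ℚ_[ℓ])))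
    (h : ↥(T.heckeImage hD K)) {m : AlgebraicClosure ℚ_[ℓ] ⊗[ℚ_[ℓ]] C.etaleH1 ℓ K} (hm : m ∈ LinearMap.range iW) :
    ((rationalTateAction (C.A K) ℓ (h : (C.A K).endAlgebra)).dualMap).baseChange (AlgebraicClosure ℚ_[ℓ]) m ∈ LinearMap.range iW := by
  rw [hW] at hm ⊢
  obtain ⟨m, rfl⟩ := hm
  refine ⟨((rationalTateAction (C.A K) ℓ (h : (C.A K).endAlgebra)).dualMap).baseChange (AlgebraicClosure ℚ_[ℓ]) m, ?_⟩
  change ((((rationalTateAction (C.A K) ℓ ε).dualMap).baseChange (AlgebraicClosure ℚ_[ℓ])) ∘ₗ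
      ((rationalTateAction (C.A K) ℓ (h : (C.A K).endAlgebra)).dualMap).baseChange (AlgebraicClosure ℚ_[ℓ])) m =
    ((((rationalTateAction (C.A K) ℓ (h : (C.A K).endAlgebra)).dualMap).baseChange (AlgebraicClosure ℚ_[ℓ])) ∘ₗ
      ((rationalTateAction (C.A K) ℓ ε).dualMap).baseChange (AlgebraicClosure ℚ_[ℓ])) m
  rw [← baseChange_dualMap_rationalTateAction_mul ℓ K, ← baseChange_dualMap_rationalTateAction_mul ℓ K, hεc _ h.2]

/-- **`W_ε` has finitely many isotypic components over `A`** (`W_ε` is finite-dimensional over `ℚ̄_ℓ ⊆ A`, hence Noetherian over `A`).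
[cite: Lam2001FirstCourse, §22 Prop. (22.1) (p. 327)] -/
theorem finite_isotypicComponents_blockCarrier [Module.Finite (AlgebraicClosure ℚ_[ℓ]) Wε]
    (A : Subalgebra (AlgebraicClosure ℚ_[ℓ]) (Module.End (AlgebraicClosure ℚ_[ℓ]) Wε)) :
    (isotypicComponents ↥A Wε).Finite := by
  haveI : IsNoetherian (AlgebraicClosure ℚ_[ℓ]) Wε := inferInstance
  haveI : IsNoetherian ↥A Wε := isNoetherian_of_tower (AlgebraicClosure ℚ_[ℓ]) inferInstance
  exact Set.toFinite _

/-! ## §3 The simple sub-block `N₀′ = {w ∈ W_ε | [iW w]_K ∈ f′(ω^K)}` of `ω⋆` -/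

include hI hX hf hiW in
/-- **The `ω⋆`-sub-block of the carrier is a SIMPLE `A`-submodule.**  For a non-zero `f′ ∈ Hom_G(ι∘ω, ℚ̄_ℓ ⊗ H¹_ét(A_∞))` out of an
IRREDUCIBLE `ω` whose `K`-fixed values are fixed by `ᵗV_ℓ^ℚ ε ⊗ 1` (`hsel`, the selector identity of the block), the subspace `N₀′` of `w ∈ W_ε`
whose image `[iW w]_K` is a value `f′ w′`, `w′ ∈ ω^K`, is a non-zero `A`-submodule of `W_ε` with no non-zero proper `act′`-stable subspace (★
`eq_bot_or_coe_eq_of_forall_heckeEnd_stable`, pulled back along the injective `iW`) — a simple `A`-module.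
[cite: Liu2021, p. 133 (D.3) and §4.2 (FJcycle.tex l. 2160–2166)] [cite: Bump1997, §4.2 Prop. 4.2.3] -/
theorem exists_simple_omegaBlock (hD : T.IsogenyDescent) [ρW.IsIrreducible]
    (hf0 : ∃ w ∈ ρW.fixedPoints (K.1.1 : Subgroup C.G), f w ≠ 0)
    {ε : (C.A K).endAlgebra}
    (hsel : ∀ w ∈ ρW.fixedPoints (K.1.1 : Subgroup C.G), ∀ x : (AlgebraicClosure ℚ_[ℓ]) ⊗[ℚ_[ℓ]] C.etaleH1 ℓ K,
        (C.toTower ℓ K).baseChange (AlgebraicClosure ℚ_[ℓ]) x = f w →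
          (C.toTower ℓ K).baseChange (AlgebraicClosure ℚ_[ℓ])
            (((rationalTateAction (C.A K) ℓ ε).dualMap).baseChange (AlgebraicClosure ℚ_[ℓ]) x) = f w)
    (hW : LinearMap.range iW = LinearMap.range (((rationalTateAction (C.A K) ℓ ε).dualMap).baseChange (AlgebraicClosure ℚ_[ℓ])))
    (act' : ↥(T.heckeImage hD K) → Module.End (AlgebraicClosure ℚ_[ℓ]) Wε)
    (hact : ∀ (h : ↥(T.heckeImage hD K)) (w : Wε),
      iW (act' h w) = ((rationalTateAction (C.A K) ℓ (h : (C.A K).endAlgebra)).dualMap).baseChange (AlgebraicClosure ℚ_[ℓ]) (iW w)) :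
    ∃ N₀ : Submodule ↥(Algebra.adjoin (AlgebraicClosure ℚ_[ℓ]) (Set.range act')) Wε,
      IsSimpleModule ↥(Algebra.adjoin (AlgebraicClosure ℚ_[ℓ]) (Set.range act')) ↥N₀ ∧
      ∀ w : Wε, w ∈ N₀ ↔
        (C.toTower ℓ K).baseChange (AlgebraicClosure ℚ_[ℓ]) (iW w) ∈ (ρW.fixedPoints (K.1.1 : Subgroup C.G)).map f := by
  classical
  obtain ⟨j, hj⟩ : ∃ j : (AlgebraicClosure ℚ_[ℓ] ⊗[ℚ_[ℓ]] C.etaleH1 ℓ K) →ₗ[AlgebraicClosure ℚ_[ℓ]]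
      AlgebraicClosure ℚ_[ℓ] ⊗[ℚ_[ℓ]] C.etaleH1Tower ℓ, j = (C.toTower ℓ K).baseChange (AlgebraicClosure ℚ_[ℓ]) := ⟨_, rfl⟩
  have hjinj : Function.Injective j := by rw [hj]; exact toTower_baseChange_injective C ℓ (C.toTower_injective ℓ hI K)
  obtain ⟨S, hS⟩ : ∃ S : Set (Module.End (AlgebraicClosure ℚ_[ℓ]) (AlgebraicClosure ℚ_[ℓ] ⊗[ℚ_[ℓ]] C.etaleH1 ℓ K)),
      S = Set.range fun g : C.G => ((rationalTateAction (C.A K) ℓ (T.heckeEnd hD K g)).dualMap).baseChange (AlgebraicClosure ℚ_[ℓ]) :=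
    ⟨_, rfl⟩
  -- the `M`-level block module `N_M = j⁻¹ f′(ω^K)`, an `L⟨S⟩`-submodule
  obtain ⟨NM, hNM⟩ := T.exists_submodule_adjoin_restrictScalars_eq K X hX ι ρW hf hD S hS
  have hmemNM : ∀ x, x ∈ NM ↔ j x ∈ (ρW.fixedPoints (K.1.1 : Subgroup C.G)).map f := fun x => by
    rw [← Submodule.restrictScalars_mem (AlgebraicClosure ℚ_[ℓ]), hNM, Submodule.mem_comap, hj]
  have hNMstab : ∀ (h : ↥(T.heckeImage hD K)), ∀ x ∈ NM,
      ((rationalTateAction (C.A K) ℓ (h : (C.A K).endAlgebra)).dualMap).baseChange (AlgebraicClosure ℚ_[ℓ]) x ∈ NM := by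
    intro h x hx
    have hmem : ((rationalTateAction (C.A K) ℓ (h : (C.A K).endAlgebra)).dualMap).baseChange (AlgebraicClosure ℚ_[ℓ]) ∈
        Algebra.adjoin (AlgebraicClosure ℚ_[ℓ]) S := by
      rw [hS]; exact T.baseChange_dualMap_rationalTateAction_mem_adjoin ℓ K hD h.2
    exact NM.smul_mem ⟨_, hmem⟩ hx
  -- the pull-back `P` along `iW`, an `act′`-stable subspace of `W_ε`
  obtain ⟨P, hmemP⟩ : ∃ P : Submodule (AlgebraicClosure ℚ_[ℓ]) Wε, ∀ w, w ∈ P ↔ iW w ∈ NM :=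
    ⟨(NM.restrictScalars (AlgebraicClosure ℚ_[ℓ])).comap iW, fun w => Iff.rfl⟩
  have hPstab : ∀ s ∈ Set.range act', ∀ w ∈ P, s w ∈ P := by
    rintro _ ⟨h, rfl⟩ w hw
    rw [hmemP, hact]
    exact hNMstab h _ ((hmemP w).1 hw)
  obtain ⟨N₀, hN₀⟩ := Literature.NumberTheory.Automorphic.exists_submodule_adjoin_of_forall_mem (Set.range act') P hPstab
  have hmemN₀ : ∀ w, w ∈ N₀ ↔ j (iW w) ∈ (ρW.fixedPoints (K.1.1 : Subgroup C.G)).map f := fun w => by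
    rw [← Submodule.restrictScalars_mem (AlgebraicClosure ℚ_[ℓ]), hN₀, hmemP, hmemNM]
  -- `N₀ ≠ 0`
  have hN0 : N₀ ≠ ⊥ := by
    obtain ⟨w₀, hw₀, hfw₀⟩ := hf0
    obtain ⟨x, hx⟩ := T.apply_mem_range_toTower_baseChange K hI X hX ι ρW hf hD hw₀
    have hxW : x ∈ LinearMap.range iW := by
      rw [hW]
      refine ⟨x, hjinj ?_⟩
      rw [hj, hsel w₀ hw₀ x hx, hx]
    obtain ⟨w, rfl⟩ := hxW
    intro hbot
    have hwN : w ∈ N₀ := by rw [hmemN₀, hj, hx]; exact Submodule.mem_map.2 ⟨w₀, hw₀, rfl⟩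
    rw [hbot, Submodule.mem_bot] at hwN
    apply hfw₀
    rw [← hx, hwN, map_zero, map_zero]
  refine ⟨N₀, Literature.RingTheory.SimpleModule.isSimpleModule_of_forall_stable (Set.range act') N₀ hN0 fun U hU hUS => ?_,
    fun w => by rw [hmemN₀, hj]⟩
  -- an `act′`-stable `U ≤ N₀` maps under `iW` to a Hecke-stable subspace of `j⁻¹ f′(ω^K)`
  obtain ⟨U', hU'⟩ : ∃ U' : Submodule (AlgebraicClosure ℚ_[ℓ]) (AlgebraicClosure ℚ_[ℓ] ⊗[ℚ_[ℓ]] C.etaleH1 ℓ K), U' = U.map iW := ⟨_, rfl⟩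
  have hmemU' : ∀ x, x ∈ U' ↔ ∃ u ∈ U, iW u = x := fun x => by rw [hU', Submodule.mem_map]
  have hU'sub : (U' : Set (AlgebraicClosure ℚ_[ℓ] ⊗[ℚ_[ℓ]] C.etaleH1 ℓ K)) ⊆
      ((ρW.fixedPoints (K.1.1 : Subgroup C.G)).map f).comap ((C.toTower ℓ K).baseChange (AlgebraicClosure ℚ_[ℓ])) := by
    intro x hx
    obtain ⟨w, hw, rfl⟩ := (hmemU' x).1 hx
    have hwN : w ∈ N₀ := hU hw
    rw [hmemN₀, hj] at hwN
    exact hwN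
  have hU'S : ∀ s ∈ S, ∀ u ∈ U', s u ∈ U' := by
    intro s hs x hx
    rw [hS] at hs
    obtain ⟨g, rfl⟩ := hs
    obtain ⟨w, hw, rfl⟩ := (hmemU' x).1 hx
    rw [hmemU']
    exact ⟨act' ⟨T.heckeEnd hD K g, T.heckeEnd_mem_heckeImage hD K g⟩ w, hUS _ ⟨_, rfl⟩ w hw, hact _ w⟩
  rcases T.eq_bot_or_coe_eq_of_forall_heckeEnd_stable K hI X hX ι ρW hf hD U' hU'sub (by rw [← hS]; exact hU'S) with h | h
  · left
    refine (Submodule.eq_bot_iff _).2 fun u hu => hiW ?_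
    have : iW u ∈ U' := (hmemU' _).2 ⟨u, hu, rfl⟩
    rw [h, Submodule.mem_bot] at this
    rw [this, map_zero]
  · right
    refine Set.Subset.antisymm hU fun w hw => ?_
    have hw' : iW w ∈ (U' : Set (AlgebraicClosure ℚ_[ℓ] ⊗[ℚ_[ℓ]] C.etaleH1 ℓ K)) := by
      rw [h]
      have := (hmemN₀ w).1 hw
      rw [hj] at this
      exact this
    obtain ⟨u, hu, hiu⟩ := (hmemU' _).1 hw'
    rw [SetLike.mem_coe, ← hiW hiu]
    exact hu

end Carrier

end Sec42Data.HeckeTranslates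

end Literature.NumberTheory.Automorphic.Liu2021.AppendixC
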